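import Literature.Computability.AlgebraicComplexity.AlmanLi2026CwPrimeTensor
import Literature.Computability.AlgebraicComplexity.MatMulDirectSumMinimalBorderRank
import HarnessLib

/-!
# `cw'_2` has border rank `4`: `R̲(cw'_2) = R(cw'_2) = 4` (Coppersmith–Winograd 1990, §11)

Topic `Literature/Computability/AlgebraicComplexity` (family `MatrixMultiplication`). PROVED, no named
facts, no definitions.

The symmetric variant of the small Coppersmith–Winograd tensor,
`cw'_2 = x₁y₂z₃ + x₁y₃z₂ + x₂y₁z₃ + x₂y₃z₁ + x₃y₁z₂ + x₃y₂z₁ ∈ (K³)^{⊗3}` (the tree's `cwPrimeTensor`,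
`AlmanLi2026CwPrimeTensor.lean`), is the tensor of which Coppersmith–Winograd write (1990, §11,
p. 277, held text `paper:doi-10-1016-s0747-7171-08-80013-2` p0027): "If the trilinear form
`x₀y₁z₂ + x₀y₂z₁ + x₁y₀z₂ + x₂y₀z₁ + x₁y₂z₀ + x₂y₁z₀` had border rank 3, then … we could prove `ω = 2`.
Unfortunately, this form has border rank 4."  Alman–Li (2026, §7.1, display before Cor. 7.2) record
"if one could prove `R̃(cw'_2) = 3`, then it would follow that `ω = 2`. Currently, the best known upper
bound is `R(cw'_2) = 4` (over fields of characteristic `≠ 2`)", and the tree has the upper bound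
`tensorRank_cwPrimeTensor_le_four` (`(2 : K) ≠ 0`).  This file proves the LOWER bound, over every
field, for the `K[ε]` border rank `algBorderRank` (Bläser 2013, Def. 6.1):

* `four_le_algBorderRank_cwPrimeTensor` — `4 ≤ R̲(cw'_2)` (any field);
* `algBorderRank_cwPrimeTensor` — `R̲(cw'_2) = 4` when `(2 : K) ≠ 0`;
* `four_le_tensorRank_cwPrimeTensor`, `tensorRank_cwPrimeTensor` — `4 ≤ R(cw'_2)`, and `R(cw'_2) = 4`
  when `(2 : K) ≠ 0` (the statement printed by Alman–Li).

## Proof (Strassen's equations for minimal border rank, as in `MatMulDirectSumMinimalBorderRank.lean`)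

`cw'_2` has format `3 × 3 × 3`. If `R̲(cw'_2) ≤ 3`, an approximate decomposition with exactly `3`
triads exists, hence one of the tensor `L` of all `K`-linear combinations `ξ` of the first-factor
slices, `L(ξ) = (∑ₐ ξₐ cw'_2(a,b,c))_{b,c} = [[0, ξ₂, ξ₁], [ξ₂, 0, ξ₀], [ξ₁, ξ₀, 0]]`.  By the tree's
`slice_mul_adjugate_mul_comm_of_isApproxDecomposition` (Landsberg 2017, Prop. 2.2.1.3 / §2.4.1),
`L(ξ) adj(L(ξ')) L(ξ'') = L(ξ'') adj(L(ξ')) L(ξ)` for all `ξ, ξ', ξ''`.  Take `ξ' = (1,1,1)`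
(`L = J − I`, `adj(J − I) = J − 2I`), `ξ = e₀` (`L = E₁₂ + E₂₁`), `ξ'' = e₁` (`L = E₀₂ + E₂₀`): the
entry `(2,0)` of the left side is `1` and of the right side is `0` — in every characteristic
(no division by `det (J − I) = 2` occurs).  Hence `R̲(cw'_2) ≥ 4`, and `R(cw'_2) ≥ R̲(cw'_2)`.

## References

* D. Coppersmith, S. Winograd, *Matrix multiplication via arithmetic progressions*, J. Symbolic
  Comput. 9 (1990) 251–280, §11, p. 277 (held). [CoppersmithWinograd1990]
* J. Alman, B. Li, *Asymptotic Rank Speedup Theorems, Revisited*, arXiv:2605.21738 (2026) = CCC 2026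
  (LIPIcs 383:36), §7.1, display before Cor. 7.2 (held `paper:arxiv-2605.21738`, p0017). [AlmanLi2026]
* J. M. Landsberg, *Geometry and Complexity Theory*, CUP 2017, Prop. 2.2.1.3, §2.4.1 (Strassen's
  equations; formalised in `StrassenMinimalBorderRank.lean`). [Landsberg2017]
* M. Bläser, *Fast Matrix Multiplication*, Theory of Computing Graduate Surveys 5 (2013), Def. 6.1
  (border rank over `K[ε]`). [Blaser2013]
-/

noncomputable section

open scoped BigOperators Polynomial Matrix
open Matrix Polynomial

namespace Literature.Computability.AlgebraicComplexity

universe u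

variable (K : Type u) [Field K]

/-- The `K`-linear combinations of the first-factor slices of `cw'_2`:
`(∑ₐ ξₐ cw'_2(a,b,c))_{b,c} = [[0, ξ₂, ξ₁], [ξ₂, 0, ξ₀], [ξ₁, ξ₀, 0]]` (zero diagonal; the entry at
`b ≠ c` is the coefficient of the third index). [cite: CoppersmithWinograd1990, §11] -/
theorem of_sum_smul_slice_cwPrimeTensor (ξ : Fin 3 → K) :
    (Matrix.of fun b c => ∑ a, ξ a * cwPrimeTensor K a b c) =
      !![0, ξ 2, ξ 1; ξ 2, 0, ξ 0; ξ 1, ξ 0, 0] := by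
  ext b c
  fin_cases b <;> fin_cases c <;> simp [Fin.sum_univ_three, cwPrimeTensor_apply]

/-- **`R̲(cw'_2) ≥ 4` over every field** ("Unfortunately, this form has border rank 4",
Coppersmith–Winograd 1990, §11, p. 277): `cw'_2` is not of minimal border rank, by Strassen's
equations — for the slices `X = E₁₂+E₂₁`, `Z = J−I`, `Y = E₀₂+E₂₀` one has
`(X adj(Z) Y)₂₀ = 1 ≠ 0 = (Y adj(Z) X)₂₀`. [cite: CoppersmithWinograd1990, §11 (p. 277)] -/
theorem four_le_algBorderRank_cwPrimeTensor : 4 ≤ algBorderRank (cwPrimeTensor K) := by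
  classical
  by_contra hlt
  rw [not_le, Nat.lt_succ_iff] at hlt
  obtain ⟨h, hh⟩ := exists_algBorderRank_eq_approxRank (cwPrimeTensor K)
  have h3 : approxRank h (cwPrimeTensor K) ≤ 3 := hh ▸ hlt
  obtain ⟨u, v, w, hd⟩ := exists_isApproxDecomposition_of_approxRank_le h3
  -- pass to the tensor of linear combinations of slices
  have hdL := hd.linearCombination
  -- Strassen's equations for the slices `e₀`, `(1,1,1)`, `e₁`
  have hS := slice_mul_adjugate_mul_comm_of_isApproxDecomposition hdL
    (fun a => if a = 0 then 1 else 0) (fun _ => 1) (fun a => if a = 1 then 1 else 0)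
  simp only [of_sum_smul_slice_cwPrimeTensor] at hS
  have e := congr_fun (congr_fun hS 2) 0
  simp [Matrix.adjugate_fin_three_of] at e

/-- **`R̲(cw'_2) = 4` over fields of characteristic `≠ 2`** (Coppersmith–Winograd 1990, §11: "this
form has border rank 4"; upper bound from the printed rank-`4` expression,
`tensorRank_cwPrimeTensor_le_four`). [cite: CoppersmithWinograd1990, §11 (p. 277)] -/
theorem algBorderRank_cwPrimeTensor (h2 : (2 : K) ≠ 0) : algBorderRank (cwPrimeTensor K) = 4 :=
  le_antisymm ((algBorderRank_le_tensorRank _).trans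
    (AlmanLi2026.tensorRank_cwPrimeTensor_le_four K h2)) (four_le_algBorderRank_cwPrimeTensor K)

/-- **`R(cw'_2) ≥ 4` over every field** (from the border-rank bound).
[cite: AlmanLi2026, §7.1 (display before Cor. 7.2)] -/
theorem four_le_tensorRank_cwPrimeTensor : 4 ≤ tensorRank (cwPrimeTensor K) :=
  (four_le_algBorderRank_cwPrimeTensor K).trans (algBorderRank_le_tensorRank _)

/-- **`R(cw'_2) = 4` over fields of characteristic `≠ 2`**, as printed: "Currently, the best known
upper bound is `R(cw'_2) = 4` (over fields of characteristic `≠ 2`)" (Alman–Li 2026, §7.1).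
[cite: AlmanLi2026, §7.1 (display before Cor. 7.2)] -/
theorem tensorRank_cwPrimeTensor (h2 : (2 : K) ≠ 0) : tensorRank (cwPrimeTensor K) = 4 :=
  le_antisymm (AlmanLi2026.tensorRank_cwPrimeTensor_le_four K h2)
    (four_le_tensorRank_cwPrimeTensor K)

end Literature.Computability.AlgebraicComplexity

end
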